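import Literature.IUT.HodgeTheaters.TemperedCoveringsCor23viSurfaceTypeGluing
import Literature.IUT.HodgeTheaters.TemperedCoveringsTranslationCoverings
import HarnessLib

/-!
# [IUTchI] Cor. 2.3 (vi) at surface type, III: branch values of cusp characters and the gluing data along the edges
# of a doubly-bound cusp configuration ([SemiAnbd] Ex. 2.10, §3 p. 36)

S. Mochizuki, *Semi-graphs of anabelioids*, Publ. RIMS **42** (2006), Example 2.10 p. 31, §3 p. 36, Def. 3.5 (i) p. 37
[cite: MochizukiSemiAnbd2006, Ex. 2.10 p.31]; [IUTchI] Cor. 2.3 (vi) pp. 48–49 [cite: Mochizuki2012, Cor 2.3(vi) pp.48-49]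
(D-0012 claim key; series DISPUTED; nothing of it is asserted here).

PROOF-ONLY file (abc-iut cell, seat abc-iut-L5-d5 gen 10, row «COR23VI-HF-TWO-LEVEL@CAVEAT», part (2d); sequel of
`…SurfaceTypeCharacters`, `…SurfaceTypeGluing`, `…TranslationCoverings`; no definition, no instance, no notation, no
`Prop` fact).  For a semi-graph of profinite groups `𝒢` carrying abc-iut-L3's SURFACE-TYPE DATUM at a vertex `v` (the
hypothesis `hv` of `ProfiniteSemiGraph.isOfSurfaceType_toAnab`: a pro-`Σ` completion `ι : Γ_{g,r} → Π_v`, an injective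
cusp assignment `js` on the branches at `v`, branch groups `b_*(Π_e) = x · closure ι⟨c_{js b}⟩ · x⁻¹`):

* `branch_values` — a continuous character `χ : Π_v → A` with `χ(ι c_j) = val j` takes on `b_*(Π_e)` only values in
  `ℤ · val(js b)`, attains `val(js b)`, and `Π_e` is topologically cyclic;
* `glue_of_data` / `glue₁_of_data` — along an edge with two abutting branches `(b, v)`, `(b', v')`, NON-TRIVIAL
  line-valued characters `χ_v ∘ b_*`, `χ_{v'} ∘ b'_*` into `𝔽_ℓ²` (resp. `ℤ/ℓ`) have isomorphic translation actions —
  the gluing isomorphisms `S_e ≅ b^* S_v` of [SemiAnbd] §3 p. 36 for the translation coverings of the sequel;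
* `eq_or_eq_of_edgeOf_eq` — an edge has exactly two branches.

Nothing of [SemiAnbd]/[IUTchI] is asserted; no side taken on [IUTchIII] Cor. 3.12; nothing here asserts that abc is
proved or refuted.
-/

noncomputable section

namespace Literature.IUT.HodgeTheaters

open _root_.Topology CategoryTheory
open scoped Pointwise
open Literature.AnabelianGeometry.SemiGraphs
open Literature.AnabelianGeometry.SemiGraphs.ProfiniteSemiGraph
open Literature.AnabelianGeometry.SemiGraphs.SemiGraphOfAnabelioids (IsProSigmaCompletion)
open Literature.GroupTheory.CombinatorialGroupTheory
open Literature.GroupTheory.CombinatorialGroupTheory.PuncturedSurfaceGroup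
open Multiplicative SurfaceTypeCharacters TranslationCover

namespace DoublyBoundCusp

variable {𝒢 : ProfiniteSemiGraph.{0}}

/-- Three branches of one edge: two of them coincide (an edge has exactly two branches). [cite: MochizukiSemiAnbd2006, §1 p.11] -/
theorem eq_or_eq_of_edgeOf_eq {x y z : 𝒢.graph.Branch} (hxy : x ≠ y) (hy : 𝒢.graph.edgeOf y = 𝒢.graph.edgeOf x)
    (hz : 𝒢.graph.edgeOf z = 𝒢.graph.edgeOf x) : z = x ∨ z = y := by
  obtain ⟨c₁, c₂, -, h₁, h₂, hall⟩ := 𝒢.graph.two_branches (𝒢.graph.edgeOf x)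
  rcases hall x rfl with hx | hx <;> rcases hall y hy with hy' | hy' <;> rcases hall z hz with hz' | hz'
  all_goals first | exact Or.inl (hz'.trans hx.symm) | exact Or.inr (hz'.trans hy'.symm) |
    exact absurd (hx.trans hy'.symm) hxy

/-- Bookkeeping: `toAdd m ∈ ℤ·d` from `m ∈ ⟨ofAdd d⟩`. [cite: MochizukiSemiAnbd2006, Ex. 2.10 p.31] -/
theorem toAdd_mem_zmultiples_of_mem_zpowers {A : Type*} [AddCommGroup A] {d : A} {m : Multiplicative A}
    (h : m ∈ Subgroup.zpowers (ofAdd d)) : toAdd m ∈ AddSubgroup.zmultiples d := by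
  obtain ⟨k, rfl⟩ := Subgroup.mem_zpowers_iff.mp h
  exact AddSubgroup.mem_zmultiples_iff.mpr ⟨k, by rw [← ofAdd_zsmul, toAdd_ofAdd]⟩

section Main

variable {ℓ : ℕ} [hℓ : Fact ℓ.Prime]

/-- **Local value lemma.**  At a vertex `v` with surface structure `ι : Γ_{g,r} → Π_v` (branch groups the conjugated
closed cusp inertia groups through `js`), a continuous `χ : Π_v → M` (abelian, `M` discrete) agreeing on the cusp
generators with `ofAdd ∘ val` takes, on the branch group of `b`, only values in `ℤ · val(js b)`; the value `val(js b)`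
is attained; and the edge group `Π_e` of `b` is topologically cyclic. [cite: MochizukiSemiAnbd2006, Ex. 2.10 p.31] -/
theorem branch_values {A : Type} [AddCommGroup A] [TopologicalSpace A] [DiscreteTopology A]
    (hinj : 𝒢.IsOfInjectiveType) {v : 𝒢.graph.Vertex}
    {g r : ℕ} (ι : PuncturedSurfaceGroup g r →* 𝒢.Gv v) (js : 𝒢.graph.Star v → Fin r)
    (hbr : ∀ b : 𝒢.graph.Star v, ∃ x : 𝒢.Gv v, 𝒢.branchSubgroup b.1 v b.2 =
      ConjAct.toConjAct x • ((cuspInertia (g := g) (js b)).map ι).topologicalClosure)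
    (χ : 𝒢.Gv v →ₜ* Multiplicative A) (val : Fin r → A) (hχ : ∀ j, χ (ι (c j)) = ofAdd (val j))
    (b : 𝒢.graph.Star v) :
    (∀ t, toAdd (χ (𝒢.brHom b.1 v b.2 t)) ∈ AddSubgroup.zmultiples (val (js b))) ∧
      (∃ t, χ (𝒢.brHom b.1 v b.2 t) = ofAdd (val (js b))) ∧
      ∃ z₀ : 𝒢.Ge (𝒢.graph.edgeOf b.1), (Subgroup.zpowers z₀).topologicalClosure = ⊤ := by
  obtain ⟨x, hB⟩ := hbr b
  have hχo : IsOpen (χ.toMonoidHom.ker : Set (𝒢.Gv v)) := by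
    rw [MonoidHom.coe_ker]
    exact χ.continuous.isOpen_preimage _ (isOpen_discrete _)
  obtain ⟨z₀, hz₀, hdense⟩ := exists_dense_zpowers_edgeGroup b.1 v b.2 (hinj b.1 v b.2) ι x (js b) hB
  refine ⟨fun t => ?_, ⟨z₀, ?_⟩, z₀, hdense⟩
  · have hmem : 𝒢.brHom b.1 v b.2 t ∈ 𝒢.branchSubgroup b.1 v b.2 := ⟨t, rfl⟩
    rw [hB] at hmem
    have h : χ (𝒢.brHom b.1 v b.2 t) ∈ Subgroup.zpowers (χ (ι (c (js b)))) :=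
      apply_mem_zpowers_of_mem_conj_closure χ.toMonoidHom hχo x (js b) hmem
    rw [hχ] at h
    exact toAdd_mem_zmultiples_of_mem_zpowers h
  · rw [hz₀]
    exact ((conj_generator_mem_and_apply χ.toMonoidHom x (js b)).2).trans (hχ (js b))

/-- **Gluing datum along an edge, rank two.**  For two abutting branches `(b, v)`, `(b', v')` of one edge with
topologically cyclic edge group, characters `χ_v ∘ b_*`, `χ_{v'} ∘ b'_*` into `𝔽_ℓ²` that are NON-TRIVIAL with values
on the lines through `d ≠ 0`, resp. `d' ≠ 0`, have isomorphic translation actions (`exists_intertwiner`).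
[cite: MochizukiSemiAnbd2006, Ex. 2.10 p.31] -/
theorem glue_of_data (χ : ∀ v : 𝒢.graph.Vertex, 𝒢.Gv v →ₜ* Multiplicative (ZMod ℓ × ZMod ℓ))
    {b b' : 𝒢.graph.Branch} {v v' : 𝒢.graph.Vertex} (hb : 𝒢.graph.abuts b = some v)
    (hb' : 𝒢.graph.abuts b' = some v') (he : 𝒢.graph.edgeOf b' = 𝒢.graph.edgeOf b)
    {z₀ : 𝒢.Ge (𝒢.graph.edgeOf b)} (hz : (Subgroup.zpowers z₀).topologicalClosure = ⊤)
    {d d' : ZMod ℓ × ZMod ℓ} (hd : d ≠ 0) (hd' : d' ≠ 0)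
    (him : ∀ t, toAdd (χ v (𝒢.brHom b v hb t)) ∈ AddSubgroup.zmultiples d)
    (him' : ∀ t', toAdd (χ v' (𝒢.brHom b' v' hb' t')) ∈ AddSubgroup.zmultiples d')
    (hne : ∃ t, χ v (𝒢.brHom b v hb t) ≠ 1) (hne' : ∃ t', χ v' (𝒢.brHom b' v' hb' t') ≠ 1) :
    ∃ A : Multiplicative (ZMod ℓ × ZMod ℓ) ≃ Multiplicative (ZMod ℓ × ZMod ℓ),
      ∀ (t : 𝒢.Ge (𝒢.graph.edgeOf b)) (m : Multiplicative (ZMod ℓ × ZMod ℓ)),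
        A ((he ▸ (χ v').comp (𝒢.brHom b' v' hb') : 𝒢.Ge (𝒢.graph.edgeOf b) →ₜ* _) t * m) =
          χ v (𝒢.brHom b v hb t) * A m := by
  set ψ' : 𝒢.Ge (𝒢.graph.edgeOf b) →ₜ* Multiplicative (ZMod ℓ × ZMod ℓ) :=
    he ▸ (χ v').comp (𝒢.brHom b' v' hb') with hψ'_def
  let ψ : 𝒢.Ge (𝒢.graph.edgeOf b) →ₜ* Multiplicative (ZMod ℓ × ZMod ℓ) := (χ v).comp (𝒢.brHom b v hb)
  have hopen : ∀ φ : 𝒢.Ge (𝒢.graph.edgeOf b) →ₜ* Multiplicative (ZMod ℓ × ZMod ℓ),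
      IsOpen (φ.toMonoidHom.ker : Set (𝒢.Ge (𝒢.graph.edgeOf b))) := fun φ => by
    rw [MonoidHom.coe_ker]
    exact φ.continuous.isOpen_preimage _ (isOpen_discrete _)
  have himψ' : ∀ t, toAdd (ψ'.toMonoidHom t) ∈ AddSubgroup.zmultiples d' := fun t => by
    rw [hψ'_def]
    exact forall_transport χ hb' he (P := fun m => toAdd m ∈ AddSubgroup.zmultiples d') him' t
  have hψ : ψ.toMonoidHom ≠ 1 := by
    obtain ⟨t, ht⟩ := hne
    exact fun h => ht (by rw [show χ v (𝒢.brHom b v hb t) = ψ.toMonoidHom t from rfl, h, MonoidHom.one_apply])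
  have hψ' : ψ'.toMonoidHom ≠ 1 := by
    obtain ⟨t, ht⟩ := exists_transport χ hb' he (P := fun m => m ≠ 1) hne'
    exact fun h => ht (by rw [← hψ'_def, show ψ' t = ψ'.toMonoidHom t from rfl, h, MonoidHom.one_apply])
  obtain ⟨A, hA⟩ := exists_intertwiner hz ψ.toMonoidHom ψ'.toMonoidHom (hopen ψ) (hopen ψ') hd hd'
    (fun t => him t) himψ' hψ hψ'
  exact ⟨A, fun t m => hA t m⟩

/-- **Gluing datum along an edge, rank one** (`exists_intertwiner_zmod`). [cite: MochizukiSemiAnbd2006, Ex. 2.10 p.31] -/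
theorem glue₁_of_data (χ : ∀ v : 𝒢.graph.Vertex, 𝒢.Gv v →ₜ* Multiplicative (ZMod ℓ))
    {b b' : 𝒢.graph.Branch} {v v' : 𝒢.graph.Vertex} (hb : 𝒢.graph.abuts b = some v)
    (hb' : 𝒢.graph.abuts b' = some v') (he : 𝒢.graph.edgeOf b' = 𝒢.graph.edgeOf b)
    {z₀ : 𝒢.Ge (𝒢.graph.edgeOf b)} (hz : (Subgroup.zpowers z₀).topologicalClosure = ⊤)
    (hne : ∃ t, χ v (𝒢.brHom b v hb t) ≠ 1) (hne' : ∃ t', χ v' (𝒢.brHom b' v' hb' t') ≠ 1) :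
    ∃ A : Multiplicative (ZMod ℓ) ≃ Multiplicative (ZMod ℓ),
      ∀ (t : 𝒢.Ge (𝒢.graph.edgeOf b)) (m : Multiplicative (ZMod ℓ)),
        A ((he ▸ (χ v').comp (𝒢.brHom b' v' hb') : 𝒢.Ge (𝒢.graph.edgeOf b) →ₜ* _) t * m) =
          χ v (𝒢.brHom b v hb t) * A m := by
  set ψ' : 𝒢.Ge (𝒢.graph.edgeOf b) →ₜ* Multiplicative (ZMod ℓ) := he ▸ (χ v').comp (𝒢.brHom b' v' hb')
    with hψ'_def
  let ψ : 𝒢.Ge (𝒢.graph.edgeOf b) →ₜ* Multiplicative (ZMod ℓ) := (χ v).comp (𝒢.brHom b v hb)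
  have hopen : ∀ φ : 𝒢.Ge (𝒢.graph.edgeOf b) →ₜ* Multiplicative (ZMod ℓ),
      IsOpen (φ.toMonoidHom.ker : Set (𝒢.Ge (𝒢.graph.edgeOf b))) := fun φ => by
    rw [MonoidHom.coe_ker]
    exact φ.continuous.isOpen_preimage _ (isOpen_discrete _)
  have hψ : ψ.toMonoidHom ≠ 1 := by
    obtain ⟨t, ht⟩ := hne
    exact fun h => ht (by rw [show χ v (𝒢.brHom b v hb t) = ψ.toMonoidHom t from rfl, h, MonoidHom.one_apply])
  have hψ' : ψ'.toMonoidHom ≠ 1 := by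
    obtain ⟨t, ht⟩ := exists_transport χ hb' he (P := fun m => m ≠ 1) hne'
    exact fun h => ht (by rw [← hψ'_def, show ψ' t = ψ'.toMonoidHom t from rfl, h, MonoidHom.one_apply])
  obtain ⟨A, hA⟩ := exists_intertwiner_zmod hz ψ.toMonoidHom ψ'.toMonoidHom (hopen ψ) (hopen ψ') hψ hψ'
  exact ⟨A, fun t m => hA t m⟩

end Main

end DoublyBoundCusp

end Literature.IUT.HodgeTheaters
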